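import Summits.Ventures.Crystal3D.Theorems.StickyWulffConstantTextureLiminfTexShadowSteepPlateDefs
import Summits.Ventures.Crystal3D.Theorems.StickyWulffConstantGenericWallFloorBarlowSteerLaunchThreshold
import Summits.Ventures.Crystal3D.Theorems.StickyWulffConstantGenericWallFloorBarlowMachineStep
import Summits.Ventures.Crystal3D.Theorems.StickyWulffConstantGenericWallFloorCapStartBarlow
import Summits.Ventures.Crystal3D.Theorems.StickyWulffConstantTextureLiminfFccPresentation
import HarnessLib

/-!
# TexShadow row (e) / EDGE-ON: slot coordinates and the EXPLICIT wide steering `z = A•e + B•(L u)` (prep for the converse of the steep-plate corner)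
# (lane T, crux `TextureLiminfV5`, stmt-Ventures-23912, sub-crux EDGE-ON `stub_edgeOnS`; cf-p1 DECISION (cxlvii)(1)(a); 19480-p2 g12)

HONEST FRAMING. Venture `Summits/Ventures/Crystal3D` (cell `crystal3d-full`), route `route-Ventures-StickyWulffConstant`, helper
`--supports` the law-v5 crux `TextureLiminfV5` (stmt-Ventures-23912).  Elementary Euclidean geometry on the reference slots, standard axioms; no
certificate and no wall statement is proved; rung F-C1 not moved.

WHAT (file 1 of 2; file 2 = `…TexShadowSteepPlateLaunch`, the capper floor and `steerLaunchAt_of_not_steepPlateAt`):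
* `steerSteepCos_third_eq` — 19480-p1's threshold of record `steerSteepCos (1/3) = (17√2 − √70)/36` equals `√2·(17 − √35)/36`, the threshold of
  `wideSteerable_iff` (…BarlowSteerLaunchThreshold);
* coordinates: `inner_axial_lateral`, `basalMirror_neg_apply`, `inner_basalMirror_neg` (the twin's up-direction opposite to a slot), `upSlot_coords`,
  `upSlot_lateral`, `inner_upSlots` (`⟪w, u⟫ = 1` or `1/2` for reference up-slots);
* **`exists_wideSteer_combo_of_rise_ge`** — for unit `u`, `e` with `⟪u, e⟫ ≥ √2(17 − √35)/36`: a unit steering `z` with `‖z − e‖ ≤ 1/3`, `⟪u, z⟫ ≥ √2/2`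
  AND the decomposition `z = A•e + B•u`, `A > 0`, `B ≥ 0` (`z = e` above `√2/2`, else `e` rotated toward `u` by `arccos(17/18)`) — the form the capper-floor
  lemma consumes.
WHAT THIS IS NOT: no certificate; F-C1 not moved.
-/

noncomputable section

namespace Summit.Ventures.Crystal3D.Cruxes.TextureLiminf.TexShadow

open Summit.Ventures.Crystal3D Summit.Ventures.Crystal3D.Theorems
open Literature.MathematicalPhysics.StatisticalMechanics (fccStacking barlowStacking basalMirror basalMirror_apply_coord)
open scoped InnerProductSpace

/-! ## The threshold of record equals the launch threshold -/

/-- `steerSteepCos (1/3) = √2·(17 − √35)/36`. -/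
theorem steerSteepCos_third_eq : steerSteepCos (1 / 3) = Real.sqrt 2 * (17 - Real.sqrt 35) / 36 := by
  rw [steerSteepCos_third]
  have h70 : Real.sqrt 70 = Real.sqrt 2 * Real.sqrt 35 := by
    rw [← Real.sqrt_mul (by norm_num : (0 : ℝ) ≤ 2)]; norm_num
  rw [h70]; ring

/-! ## Coordinates -/

/-- `⟪x, y⟫ = x₂y₂ + (x₀y₀ + x₁y₁)` on `E3`: AXIAL term first, then the LATERAL part (the split used throughout this file). -/
theorem inner_axial_lateral (x y : E3) : ⟪x, y⟫_ℝ = x 2 * y 2 + (x 0 * y 0 + x 1 * y 1) := by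
  simp [PiLp.inner_apply, Fin.sum_univ_three, mul_comm]
  ring

/-- Coordinates of `basalMirror (−x)`: `(−x₀, −x₁, x₂)`. -/
theorem basalMirror_neg_apply (x : E3) :
    basalMirror (-x) 0 = -x 0 ∧ basalMirror (-x) 1 = -x 1 ∧ basalMirror (-x) 2 = x 2 := by
  refine ⟨?_, ?_, ?_⟩ <;> rw [basalMirror_apply_coord] <;> simp

/-- `⟪basalMirror (−x), y⟫ = −x₀y₀ − x₁y₁ + x₂y₂` (the twin's up-direction opposite to the slot `x`). -/
theorem inner_basalMirror_neg (x y : E3) : ⟪basalMirror (-x), y⟫_ℝ = -(x 0 * y 0) - x 1 * y 1 + x 2 * y 2 := by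
  obtain ⟨h0, h1, h2⟩ := basalMirror_neg_apply x
  rw [inner_axial_lateral, h0, h1, h2]
  ring

/-- Coordinates of the three reference up-slots. -/
theorem upSlot_coords :
    (upSlot₁ 0 = 1 / 2 ∧ upSlot₁ 1 = Real.sqrt 3 / 6 ∧ upSlot₁ 2 = Real.sqrt (2 / 3)) ∧
    (upSlot₂ 0 = -(1 / 2) ∧ upSlot₂ 1 = Real.sqrt 3 / 6 ∧ upSlot₂ 2 = Real.sqrt (2 / 3)) ∧
    (upSlot₃ 0 = 0 ∧ upSlot₃ 1 = -(Real.sqrt 3 / 3) ∧ upSlot₃ 2 = Real.sqrt (2 / 3)) := by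
  refine ⟨⟨?_, ?_, ?_⟩, ?_, ?_⟩
  · simp [upSlot₁, Literature.MathematicalPhysics.StatisticalMechanics.barlowPos_apply_zero]
  · simp [upSlot₁, Literature.MathematicalPhysics.StatisticalMechanics.barlowPos_apply_one]; ring
  · simp [upSlot₁, Literature.MathematicalPhysics.StatisticalMechanics.barlowPos_apply_two]
  · refine ⟨?_, ?_, ?_⟩ <;>
      simp [upSlot₂, Literature.MathematicalPhysics.StatisticalMechanics.barlowPos_apply_zero,
        Literature.MathematicalPhysics.StatisticalMechanics.barlowPos_apply_one,
        Literature.MathematicalPhysics.StatisticalMechanics.barlowPos_apply_two] <;> ring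
  · refine ⟨?_, ?_, ?_⟩ <;>
      simp [upSlot₃, Literature.MathematicalPhysics.StatisticalMechanics.barlowPos_apply_zero,
        Literature.MathematicalPhysics.StatisticalMechanics.barlowPos_apply_one,
        Literature.MathematicalPhysics.StatisticalMechanics.barlowPos_apply_two] <;> ring

/-- The lateral coordinates `(w₀, w₁)` of a reference up-slot are one of `(1/2, √3/6)`, `(−1/2, √3/6)`, `(0, −√3/3)`, and `w₂ = √(2/3)`. -/
theorem upSlot_lateral {w : E3} (hw : w = upSlot₁ ∨ w = upSlot₂ ∨ w = upSlot₃) :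
    ((w 0 = 1 / 2 ∧ w 1 = Real.sqrt 3 / 6) ∨ (w 0 = -(1 / 2) ∧ w 1 = Real.sqrt 3 / 6) ∨ (w 0 = 0 ∧ w 1 = -(Real.sqrt 3 / 3))) ∧
      w 2 = Real.sqrt (2 / 3) := by
  obtain ⟨⟨a0, a1, a2⟩, ⟨b0, b1, b2⟩, ⟨c0, c1, c2⟩⟩ := upSlot_coords
  rcases hw with rfl | rfl | rfl
  · exact ⟨Or.inl ⟨a0, a1⟩, a2⟩
  · exact ⟨Or.inr (Or.inl ⟨b0, b1⟩), b2⟩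
  · exact ⟨Or.inr (Or.inr ⟨c0, c1⟩), c2⟩

/-- **Mutual inner products of the reference up-slots**: `⟪w, u⟫ = 1` if `w = u`, `= 1/2` otherwise; in particular `1/2 ≤ ⟪w, u⟫`, and
`⟪w′, u⟫ = 1/2` for `w′ ≠ u`. -/
theorem inner_upSlots {w u : E3} (hw : w = upSlot₁ ∨ w = upSlot₂ ∨ w = upSlot₃) (hu : u = upSlot₁ ∨ u = upSlot₂ ∨ u = upSlot₃) :
    (1 / 2 : ℝ) ≤ ⟪w, u⟫_ℝ ∧ (w ≠ u → ⟪w, u⟫_ℝ = 1 / 2) := by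
  have h3 : Real.sqrt 3 * Real.sqrt 3 = 3 := Real.mul_self_sqrt (by norm_num)
  have h23 : Real.sqrt (2 / 3) * Real.sqrt (2 / 3) = 2 / 3 := Real.mul_self_sqrt (by norm_num)
  obtain ⟨hwl, hw2⟩ := upSlot_lateral hw
  obtain ⟨hul, hu2⟩ := upSlot_lateral hu
  have hval : ⟪w, u⟫_ℝ = w 0 * u 0 + w 1 * u 1 + 2 / 3 := by rw [inner_axial_lateral, hw2, hu2, h23]; ring
  -- same lateral pair ⇒ `w = u` (the three pairs are distinct), value `1`; different pairs ⇒ value `1/2`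
  have hs3 : 0 < Real.sqrt 3 := Real.sqrt_pos.2 (by norm_num)
  rcases hwl with ⟨w0, w1⟩ | ⟨w0, w1⟩ | ⟨w0, w1⟩ <;> rcases hul with ⟨u0, u1⟩ | ⟨u0, u1⟩ | ⟨u0, u1⟩ <;>
    rw [hval, w0, w1, u0, u1] <;> refine ⟨by nlinarith [h3], fun hne => ?_⟩ <;>
    first
    | linear_combination (1 / 36 : ℝ) * h3
    | linear_combination (-(1 / 18) : ℝ) * h3
    | (exfalso; apply hne; ext t; fin_cases t <;> simp [*])

/-! ## The steering with its decomposition along `e` and the launch slot -/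

/-- **The wide steering, with coefficients.**  For unit `u`, `e` with `⟪u, e⟫ ≥ √2(17 − √35)/36` there are `z`, `A > 0`, `B ≥ 0` with `‖z‖ = 1`,
`‖z − e‖ ≤ 1/3`, `⟪u, z⟫ ≥ √2/2` and `z = A•e + B•u` (same construction as `exists_wideSteer_of_rise_ge`). -/
theorem exists_wideSteer_combo_of_rise_ge {u e : E3} (hu : ‖u‖ = 1) (he : ‖e‖ = 1)
    (hc : Real.sqrt 2 * (17 - Real.sqrt 35) / 36 ≤ ⟪u, e⟫_ℝ) :
    ∃ (z : E3) (A B : ℝ), ‖z‖ = 1 ∧ ‖z - e‖ ≤ 1 / 3 ∧ Real.sqrt 2 / 2 ≤ ⟪u, z⟫_ℝ ∧ 0 < A ∧ 0 ≤ B ∧ z = A • e + B • u := by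
  by_cases hbig' : Real.sqrt 2 / 2 ≤ ⟪u, e⟫_ℝ
  · exact ⟨e, 1, 0, he, by simp, hbig', one_pos, le_rfl, by simp⟩
  have hbig : ⟪u, e⟫_ℝ < Real.sqrt 2 / 2 := lt_of_not_ge hbig'
  obtain ⟨hth0, hth1⟩ := threshold_bounds
  set c : ℝ := ⟪u, e⟫_ℝ with hc_def
  have hc0 : 0 < c := lt_of_lt_of_le hth0 hc
  have hs2 : Real.sqrt 2 / 2 < 1 := by
    have : Real.sqrt 2 < 2 := by
      rw [show (2 : ℝ) = Real.sqrt (2 ^ 2) by rw [Real.sqrt_sq (by norm_num)]]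
      exact Real.sqrt_lt_sqrt (by norm_num) (by norm_num)
    linarith
  have hc1 : c < 1 := hbig.trans hs2
  have h1c : 0 < 1 - c ^ 2 := by nlinarith
  -- the in-plane unit vector
  set w : E3 := u - c • e with hw
  have hew : ⟪e, w⟫_ℝ = 0 := by rw [hw, hc_def]; exact inner_orth_component_eq_zero he
  have hw2 : ‖w‖ ^ 2 = 1 - c ^ 2 := by rw [hw, hc_def]; exact norm_sq_orth_component hu he
  have huw : ⟪u, w⟫_ℝ = 1 - c ^ 2 := by rw [hw, hc_def]; exact inner_self_orth_component hu
  have hwpos : 0 < ‖w‖ := by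
    rcases (norm_nonneg w).eq_or_lt with h | h
    · rw [← h] at hw2; norm_num at hw2; linarith
    · exact h
  have hwn : ‖w‖ = Real.sqrt (1 - c ^ 2) := by rw [← hw2, Real.sqrt_sq (norm_nonneg _)]
  set wh : E3 := ‖w‖⁻¹ • w with hwh
  have hwh1 : ‖wh‖ = 1 := by
    rw [hwh, norm_smul, Real.norm_eq_abs, abs_inv, abs_of_pos hwpos, inv_mul_cancel₀ hwpos.ne']
  have hewh : ⟪e, wh⟫_ℝ = 0 := by rw [hwh, real_inner_smul_right, hew, mul_zero]
  have hwhe : ⟪wh, e⟫_ℝ = 0 := by rw [real_inner_comm]; exact hewh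
  have huwh : ⟪u, wh⟫_ℝ = ‖w‖ := by
    rw [hwh, real_inner_smul_right, huw, ← hw2, pow_two, ← mul_assoc, inv_mul_cancel₀ hwpos.ne', one_mul]
  -- the steering and its coefficients
  set z : E3 := (17 / 18 : ℝ) • e + (Real.sqrt 35 / 18) • wh with hz
  set B : ℝ := Real.sqrt 35 / 18 * ‖w‖⁻¹ with hB
  set A : ℝ := 17 / 18 - B * c with hA
  have h35 : Real.sqrt 35 ^ 2 = 35 := Real.sq_sqrt (by norm_num)
  have h35pos : 0 < Real.sqrt 35 := Real.sqrt_pos.2 (by norm_num)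
  have hBpos : 0 < B := by rw [hB]; positivity
  have hdecomp : z = A • e + B • u := by
    rw [hz, hA, hB, hwh, hw]; module
  -- `A > 0`: `17‖w‖ > √35·c` since `324 c² < 289`
  have hApos : 0 < A := by
    have hc2 : c ^ 2 < 1 / 2 := by
      have h := mul_self_lt_mul_self hc0.le hbig
      have h22 : Real.sqrt 2 / 2 * (Real.sqrt 2 / 2) = 1 / 2 := by
        rw [div_mul_div_comm, Real.mul_self_sqrt (by norm_num : (0 : ℝ) ≤ 2)]; norm_num
      nlinarith only [h, h22]
    have hkey : Real.sqrt 35 * c < 17 * ‖w‖ := by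
      have h1 : (Real.sqrt 35 * c) ^ 2 < (17 * ‖w‖) ^ 2 := by
        rw [mul_pow, mul_pow, h35, hw2]; nlinarith only [hc2]
      rcases lt_or_ge (Real.sqrt 35 * c) (17 * ‖w‖) with h | h
      · exact h
      · exfalso
        have h17 : 0 ≤ 17 * ‖w‖ := by positivity
        have h2 := mul_self_le_mul_self h17 h
        nlinarith only [h1, h2]
    have hwinv : 0 < ‖w‖⁻¹ := inv_pos.2 hwpos
    have h2 : Real.sqrt 35 * c / 18 * ‖w‖⁻¹ < 17 * ‖w‖ / 18 * ‖w‖⁻¹ :=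
      mul_lt_mul_of_pos_right (by linarith only [hkey]) hwinv
    have h3 : 17 * ‖w‖ / 18 * ‖w‖⁻¹ = 17 / 18 := by field_simp
    have h4 : A = 17 / 18 - Real.sqrt 35 * c / 18 * ‖w‖⁻¹ := by rw [hA, hB]; ring
    rw [h4]; linarith only [h2, h3]
  -- norms and the slot's steepness (as in `exists_wideSteer_of_rise_ge`)
  have hz2 : ‖z‖ ^ 2 = 1 := by
    rw [hz, norm_sq_combo he hwh1 hewh]; nlinarith only [h35]
  have hz1 : ‖z‖ = 1 := by
    have h := Real.sqrt_sq (norm_nonneg z)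
    rw [hz2, Real.sqrt_one] at h
    exact h.symm
  have hzinner : ⟪z, e⟫_ℝ = 17 / 18 := by
    rw [hz, inner_add_left, real_inner_smul_left, real_inner_smul_left, real_inner_self_eq_norm_sq, he, hwhe]; ring
  have hze : ‖z - e‖ ≤ 1 / 3 := by
    have h : ‖z - e‖ ^ 2 = 1 / 9 := by
      rw [norm_sub_sq_real, hz2, hzinner, he]; norm_num
    have h' := Real.sqrt_sq (norm_nonneg (z - e))
    rw [h, show (1 / 9 : ℝ) = (1 / 3) ^ 2 by norm_num, Real.sqrt_sq (by norm_num : (0 : ℝ) ≤ 1 / 3)] at h'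
    exact h'.symm.le
  refine ⟨z, A, B, hz1, hze, ?_, hApos, hBpos.le, hdecomp⟩
  have huz : ⟪u, z⟫_ℝ = 17 / 18 * c + Real.sqrt 35 / 18 * Real.sqrt (1 - c ^ 2) := by
    rw [hz, inner_combo_right, ← hc_def, huwh, hwn]
  set θ : ℝ := Real.arccos c with hθ
  set β : ℝ := Real.arccos (17 / 18) with hβ
  have hcosθ : Real.cos θ = c := Real.cos_arccos (by linarith only [hc0]) hc1.le
  have hsinθ : Real.sin θ = Real.sqrt (1 - c ^ 2) := Real.sin_arccos c
  have hcosβ : Real.cos β = 17 / 18 := Real.cos_arccos (by norm_num) (by norm_num)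
  have hsinβ : Real.sin β = Real.sqrt 35 / 18 := sin_arccos_seventeen_eighteenths
  have hcs : ⟪u, z⟫_ℝ = Real.cos (θ - β) := by
    rw [Real.cos_sub, hcosθ, hsinθ, hcosβ, hsinβ, huz]; ring
  rw [hcs, ← Real.cos_pi_div_four]
  have hπ4 : Real.pi / 4 ≤ Real.pi := div_le_self Real.pi_pos.le (by norm_num)
  have hβle : β ≤ Real.pi / 4 := arccos_seventeen_eighteenths_le
  have hθge : Real.pi / 4 ≤ θ := by
    have h := Real.arccos_le_arccos hbig.le
    rwa [← Real.cos_pi_div_four, Real.arccos_cos (by positivity) hπ4] at h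
  have hθle : θ ≤ Real.pi / 4 + β := by
    rw [hθ, hβ, ← arccos_threshold]; exact Real.arccos_le_arccos hc
  exact Real.cos_le_cos_of_nonneg_of_le_pi (sub_nonneg.2 (hβle.trans hθge)) hπ4 (sub_le_iff_le_add.2 hθle)


end Summit.Ventures.Crystal3D.Cruxes.TextureLiminf.TexShadow

end
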